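import Mathlib.Analysis.SpecialFunctions.Log.Basic
import Mathlib.Analysis.Calculus.Deriv.Pow
import Mathlib.Analysis.Calculus.Deriv.Inv
import Mathlib.RingTheory.Localization.Module
import Mathlib.Algebra.Polynomial.Div
import Literature.NumberTheory.DiophantineApproximation.KroneckerTheorem
import Literature.Barriers.KontsevichZagierPeriods.GrothendieckPeriodConjectureDependenceProofs

/-!
# `NormalFormPrinciple` (stmt-KontsevichZagierPeriods-3869), line `SketchIdeator1` — the leaf
# `stub_boxRigidity` in dimension one, V: the algebra and arithmetic of `ℚ`-split denominators

Pure proof file (lead seat c3; `--supports` the crux), independent of the move files. Contents: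

* **the arithmetic input of the layer**: `1` and the logarithms of the primes are linearly
  independent over `ℚ` (`linearIndependent_one_log_prime`,
  `eq_zero_of_rat_add_sum_mul_log_prime_eq_zero`) — unique factorisation (tree:
  `Kronecker.linearIndependent_log_of_prime`) plus the transcendence of `log q` for
  `q ∈ ℚ_{>0} ∖ {1}` (Hermite–Lindemann; tree:
  `Literature.Barriers.KontsevichZagierPeriods.transcendental_log_ratCast`);
* **one peeling step of the partial-fraction expansion over `ℚ`** (`exists_peel_pole`, registered
  sub-goal): `p/q = c/(t − ρ)^{k+1} + p₁/q₁` with `q₁` a proper divisor of `q`;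
* primitives: every `A ∈ ℚ[X]` has a polynomial primitive (`exists_polynomial_hasDerivAt`), and
  `(a/(u−ρ)^{j+1})' = −a(j+1)/(u−ρ)^{j+2}` (`hasDerivAt_const_div_pow`).

Sources: M. Kontsevich, D. Zagier, *Periods* (2001), §1.2; J. Fresán, *Une introduction aux périodes*
(2024), Ex. 2.5 (`log q` is transcendental). No definitions are introduced.
-/

noncomputable section

open Finset
open scoped Polynomial

namespace Summit.KontsevichZagierPeriods.HurwitzMicroSectors.NormalFormPrinciple.PiBox

namespace Dlog

/-! ## The arithmetic input: `1` and the logarithms of the primes are `ℚ`-linearly independent -/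

/-- **`1` and the `log p` (`p` prime) are linearly independent over `ℤ`**: an integer relation
`m₀ + Σ m_p log p = 0` gives `log v = −m₀` for the positive rational `v = ∏ p^{m_p}`; if `v ≠ 1` this
contradicts the transcendence of `log v` (Hermite–Lindemann, tree `transcendental_log_ratCast`), and
if `v = 1` unique factorisation gives `m_p = 0`. [folklore] -/
theorem linearIndependent_one_log_prime (S : Finset ℕ) (hS : ∀ p ∈ S, p.Prime) :
    LinearIndependent ℤ (fun o : Option S => o.elim (1:ℝ) fun p => Real.log (p : ℕ)) := by
  classical
  rw [Fintype.linearIndependent_iff]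
  intro g hg
  rw [Fintype.sum_option] at hg
  simp only [Option.elim_none, Option.elim_some, zsmul_eq_mul, mul_one] at hg
  -- the positive rational `v = ∏ p^{g p}`
  set v : ℚ := ∏ p : S, ((p : ℕ) : ℚ) ^ (g (some p)) with hv
  have hvpos : 0 < v := Finset.prod_pos fun p _ => zpow_pos (by exact_mod_cast (hS p p.2).pos) _
  have hlogv : Real.log (v : ℝ) = ∑ p : S, (g (some p) : ℝ) * Real.log (p : ℕ) := by
    rw [hv]
    push_cast
    rw [Real.log_prod fun p _ => zpow_ne_zero _ (by exact_mod_cast (hS p p.2).ne_zero)]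
    refine Finset.sum_congr rfl fun p _ => ?_
    rw [Real.log_zpow]
  have hrel : Real.log (v : ℝ) = -(g none : ℝ) := by rw [hlogv]; linarith
  -- `v = 1`: otherwise `log v` would be transcendental and an integer
  have hv1 : v = 1 := by
    by_contra hne
    have ht := Literature.Barriers.KontsevichZagierPeriods.transcendental_log_ratCast v hvpos hne
    exact ht (by rw [hrel]; exact (isAlgebraic_int (R := ℚ) (g none)).neg)
  have h0 : g none = 0 := by
    have : (g none : ℝ) = 0 := by
      have h := hrel
      rw [hv1] at h
      push_cast at h
      rw [Real.log_one] at h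
      linarith
    exact_mod_cast this
  -- unique factorisation for the rest
  have hZ := Literature.NumberTheory.DiophantineApproximation.Kronecker.linearIndependent_log_of_prime
    S hS
  rw [Fintype.linearIndependent_iff] at hZ
  have hrest : ∀ p : S, g (some p) = 0 := by
    refine hZ (fun p => g (some p)) ?_
    have : ∑ p : S, (g (some p) : ℝ) * Real.log (p : ℕ) = 0 := by
      rw [← hlogv, hv1]; simp
    simpa [zsmul_eq_mul] using this
  intro o
  cases o with
  | none => exact h0
  | some p => exact hrest p

/-- **A vanishing rational combination `r + Σ_{p ∈ S} C_p log p = 0` over a finite set of primes has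
`r = 0` and all `C_p = 0`** (`linearIndependent_one_log_prime` upgraded from `ℤ` to `ℚ` along
`ℤ ⊂ ℚ`). [folklore] -/
theorem eq_zero_of_rat_add_sum_mul_log_prime_eq_zero {S : Finset ℕ} (hS : ∀ p ∈ S, p.Prime)
    (r : ℚ) (C : ℕ → ℚ) (h : (r:ℝ) + ∑ p ∈ S, (C p : ℝ) * Real.log p = 0) :
    r = 0 ∧ ∀ p ∈ S, C p = 0 := by
  classical
  have hQ : LinearIndependent ℚ (fun o : Option S => o.elim (1:ℝ) fun p => Real.log (p : ℕ)) :=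
    (LinearIndependent.iff_fractionRing ℤ ℚ).mp (linearIndependent_one_log_prime S hS)
  rw [Fintype.linearIndependent_iff] at hQ
  have hsum : ∑ o : Option S, (Option.elim o r fun p => C p : ℚ) •
      (o.elim (1:ℝ) fun p => Real.log (p : ℕ)) = 0 := by
    rw [Fintype.sum_option]
    simp only [Option.elim_none, Option.elim_some, Rat.smul_def, mul_one]
    rw [← h, ← Finset.sum_coe_sort S]
  have h0 := hQ (fun o => Option.elim o r fun p => C p) hsum
  exact ⟨by simpa using h0 none, fun p hp => by simpa using h0 (some ⟨p, hp⟩)⟩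

/-! ## One peeling step of the partial-fraction expansion over `ℚ` -/

/-- **Peeling a rational pole.** If `q(ρ) = 0` (`ρ ∈ ℚ`, `q ≠ 0`) then
`p/q = c/(t − ρ)^{k+1} + p₁/q₁` wherever `q(t) ≠ 0`, with `k + 1` the multiplicity of `ρ`,
`c = p(ρ)/q₂(ρ)` for `q = (t−ρ)^{k+1} q₂`, `q₁ = (t−ρ)^k q₂` a proper divisor of `q`
(`deg q₁ < deg q`) and `p₁ = (p − c q₂)/(t − ρ) ∈ ℚ[X]`. [folklore] -/
theorem exists_peel_pole (p q : ℚ[X]) (hq : q ≠ 0) {ρ : ℚ} (hρ : q.IsRoot ρ) :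
    ∃ (k : ℕ) (c : ℚ) (p₁ q₁ : ℚ[X]), q₁ ≠ 0 ∧ q₁.natDegree < q.natDegree ∧ q₁ ∣ q ∧
      ∀ t : ℝ, (Polynomial.aeval t q : ℝ) ≠ 0 →
        (Polynomial.aeval t p : ℝ) / Polynomial.aeval t q =
          (c:ℝ) / (t - ρ) ^ (k + 1) + (Polynomial.aeval t p₁ : ℝ) / Polynomial.aeval t q₁ := by
  obtain ⟨q₂, hq₂, hndvd⟩ := q.exists_eq_pow_rootMultiplicity_mul_and_not_dvd hq ρ
  have hm : 0 < q.rootMultiplicity ρ := (Polynomial.rootMultiplicity_pos hq).mpr hρ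
  obtain ⟨k, hk⟩ : ∃ k, q.rootMultiplicity ρ = k + 1 := Nat.exists_eq_succ_of_ne_zero hm.ne'
  have hq₂ρ : q₂.eval ρ ≠ 0 := by
    intro h
    exact hndvd (Polynomial.dvd_iff_isRoot.mpr h)
  have hq₂0 : q₂ ≠ 0 := by
    rintro rfl
    simp at hq₂ρ
  set c : ℚ := p.eval ρ / q₂.eval ρ with hc
  have hroot : (p - Polynomial.C c * q₂).IsRoot ρ := by
    rw [Polynomial.IsRoot.def, Polynomial.eval_sub, Polynomial.eval_mul, Polynomial.eval_C, hc,
      div_mul_cancel₀ _ hq₂ρ, sub_self]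
  set p₁ : ℚ[X] := (p - Polynomial.C c * q₂) /ₘ (Polynomial.X - Polynomial.C ρ) with hp₁
  have hp₁' : (Polynomial.X - Polynomial.C ρ) * p₁ = p - Polynomial.C c * q₂ :=
    Polynomial.mul_divByMonic_eq_iff_isRoot.mpr hroot
  set q₁ : ℚ[X] := (Polynomial.X - Polynomial.C ρ) ^ k * q₂ with hq₁
  have hXne : (Polynomial.X - Polynomial.C ρ : ℚ[X]) ≠ 0 := Polynomial.X_sub_C_ne_zero ρ
  refine ⟨k, c, p₁, q₁, mul_ne_zero (pow_ne_zero _ hXne) hq₂0, ?_, ?_, ?_⟩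
  · have hdeg : q.natDegree = (k + 1) + q₂.natDegree := by
      conv_lhs => rw [hq₂, hk]
      rw [Polynomial.natDegree_mul (pow_ne_zero _ hXne) hq₂0, Polynomial.natDegree_pow,
        Polynomial.natDegree_X_sub_C, mul_one]
    have hdeg₁ : q₁.natDegree = k + q₂.natDegree := by
      rw [hq₁, Polynomial.natDegree_mul (pow_ne_zero _ hXne) hq₂0, Polynomial.natDegree_pow,
        Polynomial.natDegree_X_sub_C, mul_one]
    omega
  · refine ⟨Polynomial.X - Polynomial.C ρ, ?_⟩
    conv_lhs => rw [hq₂, hk]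
    rw [hq₁, pow_succ]
    ring
  · intro t ht
    have hqt : (Polynomial.aeval t q : ℝ) = (t - ρ) ^ (k + 1) * Polynomial.aeval t q₂ := by
      conv_lhs => rw [hq₂, hk]
      simp [map_mul, map_pow]
    have hq₁t : (Polynomial.aeval t q₁ : ℝ) = (t - ρ) ^ k * Polynomial.aeval t q₂ := by
      rw [hq₁]
      simp [map_mul, map_pow]
    have hpt : (Polynomial.aeval t p : ℝ) =
        (t - ρ) * Polynomial.aeval t p₁ + c * Polynomial.aeval t q₂ := by
      have h := congrArg (Polynomial.aeval t) hp₁'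
      simp only [map_mul, map_sub, Polynomial.aeval_X, Polynomial.aeval_C, eq_ratCast] at h
      linear_combination -h
    have htρ : (t:ℝ) - ρ ≠ 0 := by
      intro h
      apply ht
      rw [hqt, h]
      simp
    have hq₂t : (Polynomial.aeval t q₂ : ℝ) ≠ 0 := by
      intro h
      apply ht
      rw [hqt, h, mul_zero]
    rw [hqt, hq₁t, hpt]
    field_simp
    ring

/-! ## Primitives: polynomials and higher-order poles -/

/-- Every `A ∈ ℚ[X]` has a primitive `G ∈ ℚ[X]` as a real function: `(aeval · G)' = aeval · A`.
[folklore] -/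
theorem exists_polynomial_hasDerivAt (A : ℚ[X]) :
    ∃ G : ℚ[X], ∀ t : ℝ, HasDerivAt (fun u : ℝ => (Polynomial.aeval u G : ℝ))
      (Polynomial.aeval t A) t := by
  -- adapted from HermiteRigidityEllipticMomentKernelStubPolynomialPart `polynomialPart_exists_derivative_eq`
  suffices h : ∃ G : ℚ[X], Polynomial.derivative G = A by
    obtain ⟨G, hG⟩ := h
    refine ⟨G, fun t => ?_⟩
    have := Polynomial.hasDerivAt_aeval (R := ℚ) G t
    rwa [hG] at this
  induction A using Polynomial.induction_on' with
  | add p q hp hq =>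
    obtain ⟨Gp, hGp⟩ := hp
    obtain ⟨Gq, hGq⟩ := hq
    exact ⟨Gp + Gq, by rw [Polynomial.derivative_add, hGp, hGq]⟩
  | monomial n a =>
    refine ⟨Polynomial.C (a / ((n : ℚ) + 1)) * Polynomial.X ^ (n + 1), ?_⟩
    have hn : ((n : ℚ) + 1) ≠ 0 := by positivity
    rw [Polynomial.derivative_C_mul_X_pow, ← Polynomial.C_mul_X_pow_eq_monomial,
      Nat.add_sub_cancel]
    congr 2
    push_cast
    exact div_mul_cancel₀ a hn

/-- The primitive of a higher-order pole: `(a/(u − ρ)^{j+1})' = −a(j+1)/(u − ρ)^{j+2}` off `ρ`.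
[folklore] -/
theorem hasDerivAt_const_div_pow (a ρ : ℝ) (j : ℕ) {t : ℝ} (ht : t - ρ ≠ 0) :
    HasDerivAt (fun u : ℝ => a / (u - ρ) ^ (j + 1)) (-(a * (j + 1)) / (t - ρ) ^ (j + 2)) t := by
  have h1 : HasDerivAt (fun u : ℝ => (u - ρ) ^ (j + 1)) (((j:ℝ) + 1) * (t - ρ) ^ j) t := by
    have h := ((hasDerivAt_id t).sub_const ρ).fun_pow (j + 1)
    simp only [id_eq, Nat.cast_add, Nat.cast_one, Nat.add_sub_cancel, mul_one] at h
    exact h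
  have h2 := (h1.inv (pow_ne_zero _ ht)).const_mul a
  have h3 : (fun u : ℝ => a / (u - ρ) ^ (j + 1)) = fun u => a * ((u - ρ) ^ (j + 1))⁻¹ := by
    funext u; rw [div_eq_mul_inv]
  have h4 : -(a * (j + 1)) / (t - ρ) ^ (j + 2) =
      a * (-(((j:ℝ) + 1) * (t - ρ) ^ j) / ((t - ρ) ^ (j + 1)) ^ 2) := by
    field_simp
    ring
  rw [h3, h4]
  exact h2

end Dlog

end Summit.KontsevichZagierPeriods.HurwitzMicroSectors.NormalFormPrinciple.PiBox
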